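import Literature.NumberTheory.Transcendental.CurvePeriodsEllipticTranslationProofs

/-!
# Crux `RealOnePeriodRelations` (stmt-KontsevichZagierPeriods-10042), line `nash-retraction-thin-strip`, reshape 10:
# the TORSION-PUNCTURED affine Weierstrass curve `C_T`

Helper file of reshape 10 (the torsion / third-kind layer; lead c8).  For a period pair `L` and a finite set `T ⊂ ℂ` of
abscissae, the smooth affine curve

  `C_T = {(x, y, w) ∈ 𝔸³ | y² = x³ + Ax + B, w · ∏_{a ∈ T} (x − a) = 1}`   (`curveP L T`; `A = −g₂/4`, `B = −g₃/4`)

is `E_L` minus `O` and the points with `x ∈ T` (for `T = {℘ v}` it is the curve `Ell.curveT L v` of the translation file).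
This file provides its elementary geometry, verbatim the `curveT` section of
`Literature/NumberTheory/Transcendental/CurvePeriodsEllipticTranslationProofs.lean` with `x − ℘(v)` replaced by the product:

* `curveP`, `prodP`, `cofP`, `invX` (the polynomial representative `w · ∏_{b ≠ a}(x − b)` of `1/(x − a)`), the standard forms
  `Theta0 = ι^*θ₀`, `Theta1 = ι^*θ₁`, `dlogV T a = dx/(x − a)`, `Xi L T a = dx/((x − a) y)` (third kind, residues `±1/y_a`);
* the parametrisation `psiP L T z = (℘ z, ℘′ z/2, (∏(℘ z − a))⁻¹)`, its velocity `psiPD`, `exists_psiP_eq`,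
  `psiPD_mem_tangentSpace`, `exists_eq_smul_psiPD`, and the analytic criterion `vanishesOn_curveP_of_psi`;
* `smoothP` — `C_T` is a smooth affine curve over `ℚ̄` for algebraic `g₂, g₃` and algebraic `a ∈ T`;
* `iota_psiP`, `iota_mapsTo_P`, `pair_pderiv_iota_P`, `eval_invX_psiP`.

[cite: HuberWustholz2022, §13.2, §18.1] [cite: SilvermanAEC2009, III.2.3]
-/

noncomputable section

open scoped BigOperators Topology PeriodPair
open Set Filter MvPolynomial Complex
open Literature.NumberTheory.Transcendental Literature.NumberTheory.Transcendental.CurvePeriods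
open Literature.NumberTheory.Transcendental.CurvePeriods.Ell

namespace Summit.KontsevichZagierPeriods.SymplecticScissors.RealOnePeriodRelations

namespace TorsionLayer

variable (L : PeriodPair)

/-! ## The torsion-punctured Weierstrass curve `C_T` and its standard forms -/

/-- `D_T(x) = ∏_{a ∈ T} (x − a)` in `ℂ[x, y, w]`. [folklore] -/
def prodP (T : Finset ℂ) : MvPolynomial (Fin 3) ℂ := ∏ a ∈ T, (X 0 - C a)

/-- **The affine curve `C_T = {(x, y, w) | y² = x³ + Ax + B, w · ∏_{a ∈ T}(x − a) = 1}`**: the affine Weierstrass curve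
`E_L` minus the points with `x ∈ T` (for `T = {℘ v}` this is `Ell.curveT L v`). [folklore] -/
abbrev curveP (T : Finset ℂ) : CurveData := ⟨3, 2, ![X 1 ^ 2 - fPoly3 L, X 2 * prodP T - 1]⟩

/-- The cofactor `∏_{b ∈ T, b ≠ a} (x − b)`, so that `(x − a)⁻¹ = w · cofP T a` on `C_T` for `a ∈ T`. [folklore] -/
def cofP (T : Finset ℂ) (a : ℂ) : MvPolynomial (Fin 3) ℂ := ∏ b ∈ T.erase a, (X 0 - C b)

/-- `invX T a = w · ∏_{b ≠ a}(x − b)`, the polynomial representative of `1/(x − a)` on `C_T` (`a ∈ T`). [folklore] -/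
def invX (T : Finset ℂ) (a : ℂ) : MvPolynomial (Fin 3) ℂ := X 2 * cofP T a

/-- `θ₀^C = ι^*θ₀`, the polynomial representative of `dx/y` on `C_T`. [folklore] -/
abbrev Theta0 : Fin 3 → MvPolynomial (Fin 3) ℂ := formPullback iota (theta0 L)

/-- `θ₁^C = ι^*θ₁`, the polynomial representative of `x dx/y` on `C_T`. [folklore] -/
abbrev Theta1 : Fin 3 → MvPolynomial (Fin 3) ℂ := formPullback iota (theta1 L)

/-- `dlogV T a = dx/(x − a)` on `C_T` (`a ∈ T`). [folklore] -/
def dlogV (T : Finset ℂ) (a : ℂ) : Fin 3 → MvPolynomial (Fin 3) ℂ := ![invX T a, 0, 0]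

/-- The third-kind form `ξ_a = dx/((x − a) y)` on `C_T` (`a ∈ T`). [folklore] -/
def Xi (T : Finset ℂ) (a : ℂ) : Fin 3 → MvPolynomial (Fin 3) ℂ := invX T a • Theta0 L

/-- The parametrisation `ψ_T(z) = (℘ z, ℘′ z/2, (∏_{a ∈ T}(℘ z − a))⁻¹)` of `C_T`. [folklore] -/
def psiP (T : Finset ℂ) (z : ℂ) : Fin 3 → ℂ := ![℘[L] z, ℘'[L] z / 2, (∏ a ∈ T, (℘[L] z - a))⁻¹]


/-! ## `C_T`: points, tangent lines, the parametrisation `ψ_T`, smoothness -/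

/-- `∏_{a ∈ T}(x − a)` as a function. [folklore] -/
theorem eval_prodP (T : Finset ℂ) (q : Fin 3 → ℂ) : eval q (prodP T) = ∏ a ∈ T, (q 0 - a) := by
  rw [prodP, map_prod]
  exact Finset.prod_congr rfl fun a _ => by simp

/-- `∏_{b ∈ T, b ≠ a}(x − b)` as a function. [folklore] -/
theorem eval_cofP (T : Finset ℂ) (a : ℂ) (q : Fin 3 → ℂ) : eval q (cofP T a) = ∏ b ∈ T.erase a, (q 0 - b) := by
  rw [cofP, map_prod]
  exact Finset.prod_congr rfl fun b _ => by simp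

/-- `∂/∂y` and `∂/∂w` kill `∏ (x − a)`. [folklore] -/
theorem pderiv_prodP_of_ne_zero (T : Finset ℂ) {i : Fin 3} (hi : i ≠ 0) : pderiv i (prodP T) = 0 := by
  rw [prodP]
  refine Finset.prod_induction _ (fun F : MvPolynomial (Fin 3) ℂ => pderiv i F = 0)
    (fun F G hF hG => ?_) (by simp) (fun a _ => ?_)
  · rw [Derivation.leibniz, hF, hG, smul_zero, smul_zero, add_zero]
  · simp [pderiv_X, hi.symm]

/-- `q ∈ C_T ↔ q₁² = f(q₀) ∧ q₂ ∏ (q₀ − a) = 1`. [folklore] -/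
theorem mem_points_curveP_iff : ∀ (L : PeriodPair) (T : Finset ℂ) (q : Fin 3 → ℂ), q ∈ (curveP L T).points ↔ q 1 ^ 2 = q 0 ^ 3 + A L * q 0 + B L ∧ q 2 * ∏ a ∈ T, (q 0 - a) = 1 := by
  intro L T q
  rw [CurveData.mem_points]
  rw [show (∀ j : Fin (curveP L T).m, eval q ((curveP L T).F j) = 0) ↔
      eval q ((curveP L T).F 0) = 0 ∧ eval q ((curveP L T).F 1) = 0 from Fin.forall_fin_two]
  simp [eval_fPoly3, eval_prodP, sub_eq_zero]

/-- The gradient of `y² − f`: `(−(3x² + A), 2y, 0)`. [folklore] -/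
theorem gradient_curveP_zero (T : Finset ℂ) (q : Fin 3 → ℂ) :
    (curveP L T).gradient 0 q = ![-(3 * q 0 ^ 2 + A L), 2 * q 1, 0] := by
  funext k
  simp only [CurveData.gradient, Matrix.cons_val_zero, map_sub, Derivation.leibniz_pow,
    pderiv_fPoly3]
  fin_cases k <;> simp

/-- The gradient of `w ∏(x − a) − 1`: `(w ∂ₓ∏, 0, ∏ (x − a))`. [folklore] -/
theorem gradient_curveP_one (T : Finset ℂ) (q : Fin 3 → ℂ) :
    (curveP L T).gradient 1 q = ![q 2 * eval q (pderiv 0 (prodP T)), 0, ∏ a ∈ T, (q 0 - a)] := by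
  funext k
  simp only [CurveData.gradient, Matrix.cons_val_one]
  fin_cases k
  · simp [Derivation.leibniz, pderiv_X]
  · simp [Derivation.leibniz, pderiv_X, pderiv_prodP_of_ne_zero T (i := 1) (by decide)]
  · simp [Derivation.leibniz, pderiv_X, pderiv_prodP_of_ne_zero T (i := 2) (by decide), eval_prodP]

/-- The tangent line of `C_T` at `q`. [folklore] -/
theorem mem_tangentSpace_curveP_iff (T : Finset ℂ) (q t : Fin 3 → ℂ) :
    t ∈ (curveP L T).tangentSpace q ↔
      -(3 * q 0 ^ 2 + A L) * t 0 + 2 * q 1 * t 1 = 0 ∧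
        q 2 * eval q (pderiv 0 (prodP T)) * t 0 + (∏ a ∈ T, (q 0 - a)) * t 2 = 0 := by
  simp only [CurveData.tangentSpace, mem_setOf_eq]
  rw [show (∀ j : Fin (curveP L T).m, ∑ i, (curveP L T).gradient j q i * t i = 0) ↔
      (∑ i, (curveP L T).gradient 0 q i * t i = 0) ∧ (∑ i, (curveP L T).gradient 1 q i * t i = 0)
      from Fin.forall_fin_two, gradient_curveP_zero, gradient_curveP_one]
  simp [Fin.sum_univ_three]

/-- The product `∏_{a∈T}(℘ z − a)` as a function of `z`. [folklore] -/
def prodFun (T : Finset ℂ) (z : ℂ) : ℂ := ∏ a ∈ T, (℘[L] z - a)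

/-- Its derivative `℘′(z) · Σ_a ∏_{b ≠ a}(℘ z − b)`. [folklore] -/
def prodFunD (T : Finset ℂ) (z : ℂ) : ℂ := ∑ a ∈ T, (∏ b ∈ T.erase a, (℘[L] z - b)) * ℘'[L] z

/-- `ψ_T′(z)`. [folklore] -/
def psiPD (T : Finset ℂ) (z : ℂ) : Fin 3 → ℂ :=
  ![℘'[L] z, 3 * ℘[L] z ^ 2 - L.g₂ / 4, -prodFunD L T z / prodFun L T z ^ 2]

/-- [folklore] -/
@[simp] theorem psiP_apply_zero (T : Finset ℂ) (z : ℂ) : psiP L T z 0 = ℘[L] z := rfl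

/-- [folklore] -/
@[simp] theorem psiP_apply_one (T : Finset ℂ) (z : ℂ) : psiP L T z 1 = ℘'[L] z / 2 := rfl

/-- [folklore] -/
@[simp] theorem psiP_apply_two (T : Finset ℂ) (z : ℂ) : psiP L T z 2 = (prodFun L T z)⁻¹ := rfl

/-- [folklore] -/
@[simp] theorem psiPD_apply_zero (T : Finset ℂ) (z : ℂ) : psiPD L T z 0 = ℘'[L] z := rfl

/-- [folklore] -/
@[simp] theorem psiPD_apply_one (T : Finset ℂ) (z : ℂ) : psiPD L T z 1 = 3 * ℘[L] z ^ 2 - L.g₂ / 4 := rfl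

/-- [folklore] -/
@[simp] theorem psiPD_apply_two (T : Finset ℂ) (z : ℂ) :
    psiPD L T z 2 = -prodFunD L T z / prodFun L T z ^ 2 := rfl

/-- `ι(ψ_T(z)) = φ(z)` (first two coordinates). [folklore] -/
theorem psiP_phi (T : Finset ℂ) (z : ℂ) : ![psiP L T z 0, psiP L T z 1] = phi L z := rfl

/-- `∏ (℘ z − a) ≠ 0` iff `℘ z ∉ T`. [folklore] -/
theorem prodFun_ne_zero_iff (T : Finset ℂ) (z : ℂ) : prodFun L T z ≠ 0 ↔ ∀ a ∈ T, ℘[L] z ≠ a := by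
  rw [prodFun, Finset.prod_ne_zero_iff]
  exact forall₂_congr fun a _ => sub_ne_zero

/-- `ψ_T(z) ∈ C_T` for `z ∉ Λ` with `℘(z) ∉ T`. [folklore] -/
theorem psiP_mem_points (T : Finset ℂ) {z : ℂ} (hz : z ∉ L.lattice) (hne : prodFun L T z ≠ 0) :
    psiP L T z ∈ (curveP L T).points := by
  rw [mem_points_curveP_iff]
  refine ⟨?_, ?_⟩
  · have h := (Weier.mem_points_iff (A L) (B L) (phi L z)).1 (phi_mem_points L hz)
    rw [Weier.eval_fPoly] at h
    simpa using h
  · simp only [psiP_apply_two, psiP_apply_zero]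
    exact inv_mul_cancel₀ hne

/-- The derivative of `z ↦ ∏ (℘ z − a)`. [folklore] -/
theorem hasDerivAt_prodFun (T : Finset ℂ) {z : ℂ} (hz : z ∉ L.lattice) :
    HasDerivAt (prodFun L T) (prodFunD L T z) z := by
  classical
  have h0 := hasDerivAt_phi L hz 0
  simp only [phi_apply_zero, phiD_apply_zero] at h0
  have h := HasDerivAt.fun_finsetProd (u := T) (f := fun a w => ℘[L] w - a) (f' := fun a => ℘'[L] z)
    (x := z) (fun a _ => h0.sub_const a)
  have e : (fun w => ∏ a ∈ T, (℘[L] w - a)) = prodFun L T := rfl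
  have e' : prodFunD L T z = ∑ i ∈ T, (∏ j ∈ T.erase i, (℘[L] z - j)) • ℘'[L] z := by
    simp only [prodFunD, smul_eq_mul]
  rw [e] at h
  rw [e']
  exact h

/-- `ψ_T` has complex derivative `ψ_T′` off `Λ ∪ {℘ ∈ T}`. [folklore] -/
theorem hasDerivAt_psiP (T : Finset ℂ) {z : ℂ} (hz : z ∉ L.lattice) (hne : prodFun L T z ≠ 0) :
    ∀ k : Fin 3, HasDerivAt (fun w => psiP L T w k) (psiPD L T z k) z := by
  have h0 := hasDerivAt_phi L hz 0
  have h1 := hasDerivAt_phi L hz 1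
  simp only [phi_apply_zero, phiD_apply_zero, phi_apply_one, phiD_apply_one] at h0 h1
  intro k
  fin_cases k
  · exact h0
  · exact h1
  · show HasDerivAt (fun w => (prodFun L T w)⁻¹) (-prodFunD L T z / prodFun L T z ^ 2) z
    exact (hasDerivAt_prodFun L T hz).inv hne

/-- Along a real shift: `s ↦ ψ_T(z₀ + s)` has derivative `ψ_T′(z₀ + t)` at `t`. [folklore] -/
theorem hasDerivAt_psiP_shift (T : Finset ℂ) (z₀ : ℂ) {t : ℝ} (h : z₀ + t ∉ L.lattice)
    (hne : prodFun L T (z₀ + t) ≠ 0) (k : Fin 3) :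
    HasDerivAt (fun s : ℝ => psiP L T (z₀ + s) k) (psiPD L T (z₀ + t) k) t :=
  (HasDerivAt.comp_const_add z₀ (t : ℂ) (hasDerivAt_psiP L T h hne k)).comp_ofReal

/-- `∂ₓ ∏(x − a)` evaluated at `ψ_T(z)` is `Σ_a ∏_{b≠a}(℘ z − b)`. [folklore] -/
theorem eval_pderiv_prodP_psiP (T : Finset ℂ) (z : ℂ) :
    eval (psiP L T z) (pderiv 0 (prodP T)) * ℘'[L] z = prodFunD L T z := by
  classical
  -- differentiate `s ↦ ∏ (℘ z + s − a)` at `s = 0` in two ways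
  set γ : ℝ → (Fin 3 → ℂ) := fun s => Function.update (psiP L T z) 0 (℘[L] z + s) with hγ
  have hγ' : ∀ i, HasDerivAt (fun u => γ u i) ((Pi.single 0 1 : Fin 3 → ℂ) i) 0 := by
    intro i
    by_cases hi : i = 0
    · subst hi
      have h : HasDerivAt (fun u : ℝ => ℘[L] z + (u : ℂ)) 1 0 := by
        simpa using ((hasDerivAt_id ((0 : ℝ) : ℂ)).const_add (℘[L] z)).comp_ofReal
      simpa [hγ] using h
    · have e : (fun u : ℝ => γ u i) = fun _ => psiP L T z i := by
        funext u; simp [hγ, Function.update_of_ne hi]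
      rw [e]
      simpa [hi] using hasDerivAt_const (0 : ℝ) (psiP L T z i)
  have h1 := hasDerivAt_eval_comp (t := 0) hγ' (prodP T)
  have hγ0 : γ 0 = psiP L T z := by
    funext i
    by_cases hi : i = 0
    · subst hi; simp [hγ]
    · simp [hγ, Function.update_of_ne hi]
  rw [hγ0] at h1
  have hs : (∑ i, eval (psiP L T z) (pderiv i (prodP T)) * (Pi.single 0 1 : Fin 3 → ℂ) i) =
      eval (psiP L T z) (pderiv 0 (prodP T)) := by
    simp [Fin.sum_univ_three]
  rw [hs] at h1
  have e2 : (fun u : ℝ => eval (γ u) (prodP T)) = fun u : ℝ => ∏ a ∈ T, (℘[L] z + (u : ℂ) - a) := by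
    funext u
    rw [eval_prodP]
    simp [hγ]
  rw [e2] at h1
  have h2 : HasDerivAt (fun u : ℝ => ∏ a ∈ T, (℘[L] z + (u : ℂ) - a))
      (∑ a ∈ T, (∏ b ∈ T.erase a, (℘[L] z + ((0 : ℝ) : ℂ) - b)) • (1 : ℂ)) 0 :=
    HasDerivAt.fun_finsetProd (u := T) (f := fun a (u : ℝ) => ℘[L] z + (u : ℂ) - a)
      (f' := fun _ => (1 : ℂ)) (x := (0 : ℝ)) (fun a _ => by
        simpa using (((hasDerivAt_id ((0 : ℝ) : ℂ)).const_add (℘[L] z)).sub_const a).comp_ofReal)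
  have huniq := h1.unique h2
  rw [huniq, prodFunD, Finset.sum_mul]
  refine Finset.sum_congr rfl fun a _ => ?_
  simp only [ofReal_zero, add_zero, smul_eq_mul]
  ring

/-- `ψ_T′(z)` is tangent to `C_T` at `ψ_T(z)`. [folklore] -/
theorem psiPD_mem_tangentSpace (T : Finset ℂ) {z : ℂ} (hne : prodFun L T z ≠ 0) :
    psiPD L T z ∈ (curveP L T).tangentSpace (psiP L T z) := by
  rw [mem_tangentSpace_curveP_iff]
  have hp : ∏ a ∈ T, (psiP L T z 0 - a) = prodFun L T z := rfl
  rw [hp]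
  simp only [psiP_apply_zero, psiP_apply_one, psiP_apply_two, psiPD_apply_zero, psiPD_apply_one, psiPD_apply_two, A]
  constructor
  · ring
  · have e := eval_pderiv_prodP_psiP L T z
    field_simp
    linear_combination e

/-- **`ψ_T` parametrises `C_T`**: every point of `C_T` is `ψ_T(z)` with `z ∉ Λ`, `℘(z) ∉ T`. [folklore] -/
theorem exists_psiP_eq (T : Finset ℂ) {q : Fin 3 → ℂ} (hq : q ∈ (curveP L T).points) :
    ∃ z, z ∉ L.lattice ∧ prodFun L T z ≠ 0 ∧ psiP L T z = q := by
  rw [mem_points_curveP_iff] at hq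
  obtain ⟨hcub, hw⟩ := hq
  have hx : ∏ a ∈ T, (q 0 - a) ≠ 0 := fun h => by simp [h] at hw
  obtain ⟨z, hz, hxz⟩ := L.exists_weierstrassP_eq (q 0)
  have hne : prodFun L T z ≠ 0 := by rwa [prodFun, hxz]
  have hsq : (℘'[L] z / 2) ^ 2 = q 1 ^ 2 := by
    rw [hcub, ← hxz]
    have h := L.derivWeierstrassP_sq z hz
    simp only [A, B]
    linear_combination (1 / 4 : ℂ) * h
  have hw' : q 2 = (∏ a ∈ T, (q 0 - a))⁻¹ := eq_inv_of_mul_eq_one_left hw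
  rcases sq_eq_sq_iff_eq_or_eq_neg.1 hsq with h | h
  · refine ⟨z, hz, hne, ?_⟩
    funext k
    fin_cases k
    · simpa using hxz
    · simpa using h
    · simp [hw', ← hxz, prodFun]
  · have hz' : -z ∉ L.lattice := fun h' => hz (by simpa using neg_mem h')
    refine ⟨-z, hz', by rwa [prodFun, L.weierstrassP_neg, ← prodFun], ?_⟩
    funext k
    fin_cases k
    · simpa [L.weierstrassP_neg] using hxz
    · simp [L.derivWeierstrassP_neg, neg_div, h]
    · simp [prodFun, L.weierstrassP_neg, hw', hxz]

/-- For `z₀ ∉ Λ` with `∏(℘ z₀ − a) ≠ 0`, the same holds at `z₀ + t` for small real `t`. [folklore] -/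
theorem eventually_shift_prodFun_ne (T : Finset ℂ) {z₀ : ℂ} (hz₀ : z₀ ∉ L.lattice) (hne : prodFun L T z₀ ≠ 0) :
    ∀ᶠ t : ℝ in 𝓝 0, prodFun L T (z₀ + (t : ℂ)) ≠ 0 := by
  have hshift : Continuous fun t : ℝ => z₀ + (t : ℂ) := by fun_prop
  have hc : ContinuousAt (fun t : ℝ => prodFun L T (z₀ + (t : ℂ))) 0 := by
    have hd : ContinuousAt (prodFun L T) z₀ := (hasDerivAt_prodFun L T hz₀).continuousAt
    exact hd.comp_of_eq hshift.continuousAt (by simp)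
  exact hc.eventually_ne (by simpa using hne)

/-- `∏ (x − a)` has algebraic coefficients when the `a ∈ T` are algebraic. [folklore] -/
theorem hasAlgCoeffs_prodP {T : Finset ℂ} (hT : ∀ a ∈ T, IsAlgebraic ℚ a) : HasAlgCoeffs (prodP T) :=
  hasAlgCoeffs_finsetProd _ _ fun a ha => (hasAlgCoeffs_X 0).sub (hasAlgCoeffs_C (hT a ha))

/-- `∏_{b ≠ a} (x − b)` has algebraic coefficients when the `b ∈ T` are algebraic. [folklore] -/
theorem hasAlgCoeffs_cofP {T : Finset ℂ} (hT : ∀ a ∈ T, IsAlgebraic ℚ a) (a : ℂ) : HasAlgCoeffs (cofP T a) :=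
  hasAlgCoeffs_finsetProd _ _ fun b hb => (hasAlgCoeffs_X 0).sub (hasAlgCoeffs_C (hT b (Finset.mem_of_mem_erase hb)))

/-- `invX T a` has algebraic coefficients. [folklore] -/
theorem hasAlgCoeffs_invX {T : Finset ℂ} (hT : ∀ a ∈ T, IsAlgebraic ℚ a) (a : ℂ) : HasAlgCoeffs (invX T a) :=
  (hasAlgCoeffs_X 2).mul (hasAlgCoeffs_cofP hT a)

end TorsionLayer

end Summit.KontsevichZagierPeriods.SymplecticScissors.RealOnePeriodRelations

end
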